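import Summits.Ventures.Crystal3D.Theorems.StickyWulffConstantNoReconstructionGainExactDefs
import HarnessLib

/-!
# Film balls lie strictly above the cut, I: the planar core (line `replication-exactness`)

HONEST FRAMING. Part of the venture `Summits/Ventures/Crystal3D` (cell `crystal3d-full`), supports the
crux `NoReconstructionGain` (stmt-Ventures-19144, route `route-Ventures-StickyWulffConstant`), line
`replication-exactness` (lead wulff-p1 g18).  Pure real algebra behind the statement "the lower open
unit half-ball of every point contains a site of `Λ₀`" (part II, `…ExactFilmAboveCut`):

* `planar_halfBall_core` — for a point `y = αe + βf` of the closed sector spanned by two consecutive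
  unit lattice directions `e, f` of a close-packed layer (`⟪e,f⟫ = 1/2`) with `|y|² = α² + β² + αβ ≤ 1/3`
  (the covering radius), a height `0 ≤ Δ` with `Δ² < 2/3` (below the next layer), and a unit
  `(n₀,n₁,n₃)` with `n₃² ≥ 1/3`, `n₃ ≥ 0` (normal in the basal cone), one of the three vertices
  `c ∈ {0, e, f}` satisfies `|c − y|² + Δ² < 1` AND `⟪c − y, (n₀,n₁)⟫ ≤ Δ n₃`.  Cases: the covering
  vertex `0` unless it is "uphill" (`f_a > Δn₃`); then Cauchy–Schwarz gives `Δ² < 2|y|²`, the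
  barycentric identity `(1−α−β) f_a + α f_b + β f_c = 0` makes a neighbour downhill, and either the
  nearer neighbour is close (`3|y|² ≤ 2α + β` for `α ≥ β`) or, with two uphill vertices, the foot of
  the perpendicular bounds `Δ² < (3/2)α²` and the third vertex is close.  Margins vanish only in the
  lattice-point limit (numerics: lead folder calc/layer2d.py, 1.2·10⁶ samples, no failure).

WHAT THIS IS NOT: anything about packings by itself; rung F-C1 not moved.
-/

noncomputable section

namespace Summit.Ventures.Crystal3D.Theorems

/-! ## The planar core -/

/-- **Planar core.**  `e, f` consecutive unit lattice directions (`⟪e,f⟫ = 1/2`), `y = αe + βf` with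
`α, β ≥ 0`, `|y|² = α² + β² + αβ ≤ 1/3`; `0 ≤ Δ`, `Δ² < 2/3`; `(n₀,n₁,n₃)` unit with `n₃² ≥ 1/3`,
`n₃ ≥ 0`.  Then some vertex `c ∈ {0, e, f}` has `|c − y|² + Δ² < 1` and `⟪c − y, (n₀,n₁)⟫ ≤ Δ n₃`. -/
theorem planar_halfBall_core {e0 e1 f0 f1 α β y0 y1 n0 n1 n3 Δ : ℝ}
    (he : e0 ^ 2 + e1 ^ 2 = 1) (hf : f0 ^ 2 + f1 ^ 2 = 1) (hef : e0 * f0 + e1 * f1 = 1 / 2)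
    (hα : 0 ≤ α) (hβ : 0 ≤ β) (hg : α ^ 2 + β ^ 2 + α * β ≤ 1 / 3)
    (hy0 : y0 = α * e0 + β * f0) (hy1 : y1 = α * e1 + β * f1)
    (hn : n0 ^ 2 + n1 ^ 2 + n3 ^ 2 = 1) (hn3 : 1 / 3 ≤ n3 ^ 2) (hn3' : 0 ≤ n3)
    (hΔ0 : 0 ≤ Δ) (hΔ : Δ ^ 2 < 2 / 3) :
    ∃ c0 c1 : ℝ, ((c0 = 0 ∧ c1 = 0) ∨ (c0 = e0 ∧ c1 = e1) ∨ (c0 = f0 ∧ c1 = f1)) ∧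
      (c0 - y0) ^ 2 + (c1 - y1) ^ 2 + Δ ^ 2 < 1 ∧ (c0 - y0) * n0 + (c1 - y1) * n1 ≤ Δ * n3 := by
  -- bookkeeping identities
  have hyy : y0 ^ 2 + y1 ^ 2 = α ^ 2 + β ^ 2 + α * β := by
    rw [hy0, hy1]; linear_combination α ^ 2 * he + β ^ 2 * hf + 2 * α * β * hef
  have hey : e0 * y0 + e1 * y1 = α + β / 2 := by
    rw [hy0, hy1]; linear_combination α * he + β * hef
  have hfy : f0 * y0 + f1 * y1 = β + α / 2 := by
    rw [hy0, hy1]; linear_combination β * hf + α * hef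
  have hsum : α + β ≤ 2 / 3 := by nlinarith [sq_nonneg (α - β)]
  set t := Δ * n3 with ht
  have ht0 : 0 ≤ t := mul_nonneg hΔ0 hn3'
  set fa := -(y0 * n0 + y1 * n1) with hfa
  set fb := fa + (e0 * n0 + e1 * n1) with hfb
  set fc := fa + (f0 * n0 + f1 * n1) with hfc
  have hrel : (1 - α - β) * fa + α * fb + β * fc = 0 := by
    rw [hfb, hfc, hfa, hy0, hy1]; ring
  -- distances of the three vertices
  have hda : (0 - y0) ^ 2 + (0 - y1) ^ 2 = α ^ 2 + β ^ 2 + α * β := by rw [← hyy]; ring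
  have hdb : (e0 - y0) ^ 2 + (e1 - y1) ^ 2 = α ^ 2 + β ^ 2 + α * β - 2 * α - β + 1 := by
    linear_combination he - 2 * hey + hyy
  have hdc : (f0 - y0) ^ 2 + (f1 - y1) ^ 2 = α ^ 2 + β ^ 2 + α * β - 2 * β - α + 1 := by
    linear_combination hf - 2 * hfy + hyy
  by_cases hA : fa ≤ t
  · -- the nearest vertex is not uphill
    refine ⟨0, 0, Or.inl ⟨rfl, rfl⟩, ?_, ?_⟩
    · rw [hda]; linarith
    · have : (0 - y0) * n0 + (0 - y1) * n1 = fa := by rw [hfa]; ring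
      rw [this]; exact hA
  push Not at hA
  -- `fa > t ≥ 0`: Cauchy–Schwarz bounds `Δ² < 2 |y|²`
  have hn01 : n0 ^ 2 + n1 ^ 2 = 1 - n3 ^ 2 := by linarith
  have hCS : fa ^ 2 ≤ (α ^ 2 + β ^ 2 + α * β) * (1 - n3 ^ 2) := by
    have hid : fa ^ 2 + (y0 * n1 - y1 * n0) ^ 2 = (y0 ^ 2 + y1 ^ 2) * (n0 ^ 2 + n1 ^ 2) := by
      rw [hfa]; ring
    rw [← hyy, ← hn01]
    linarith [hid, sq_nonneg (y0 * n1 - y1 * n0)]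
  have ht2 : t ^ 2 < fa ^ 2 := by rw [pow_two, pow_two]; exact mul_self_lt_mul_self ht0 hA
  have htΔ : t ^ 2 = Δ ^ 2 * n3 ^ 2 := by rw [ht]; ring
  have hg0 : 0 ≤ α ^ 2 + β ^ 2 + α * β :=
    add_nonneg (add_nonneg (sq_nonneg _) (sq_nonneg _)) (mul_nonneg hα hβ)
  have hn3pos : 0 < n3 ^ 2 := by linarith
  have hΔg : Δ ^ 2 < 2 * (α ^ 2 + β ^ 2 + α * β) := by
    have h1 : Δ ^ 2 * n3 ^ 2 < (α ^ 2 + β ^ 2 + α * β) * (1 - n3 ^ 2) := by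
      rw [← htΔ]; exact lt_of_lt_of_le ht2 hCS
    have h2 : (α ^ 2 + β ^ 2 + α * β) * (1 - n3 ^ 2) ≤ (α ^ 2 + β ^ 2 + α * β) * (2 * n3 ^ 2) :=
      mul_le_mul_of_nonneg_left (by linarith) hg0
    have h3 : 0 < (2 * (α ^ 2 + β ^ 2 + α * β) - Δ ^ 2) * n3 ^ 2 := by linarith [h1, h2]
    have h4 : 0 < 2 * (α ^ 2 + β ^ 2 + α * β) - Δ ^ 2 := (mul_pos_iff_of_pos_right hn3pos).1 h3
    linarith
  by_cases hB : fb ≤ t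
  · by_cases hC : fc ≤ t
    · -- both neighbours are downhill: the nearer one is close (Core 2)
      rcases le_total β α with hαβ | hαβ
      · refine ⟨e0, e1, Or.inr (Or.inl ⟨rfl, rfl⟩), ?_, ?_⟩
        · have key : 3 * (α ^ 2 + β ^ 2 + α * β) ≤ 2 * α + β := by
            have hid : (2 * α + β) ^ 2 - 3 * (α ^ 2 + β ^ 2 + α * β) = (α - β) * (α + 2 * β) := by
              ring
            have h1 : 3 * (α ^ 2 + β ^ 2 + α * β) ≤ (2 * α + β) ^ 2 := by
              linarith [hid, mul_nonneg (sub_nonneg.2 hαβ) (by linarith : 0 ≤ α + 2 * β)]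
            by_cases h2 : 1 ≤ 2 * α + β
            · linarith
            · push Not at h2
              have h3 : (2 * α + β) ^ 2 ≤ 2 * α + β := by
                rw [sq]; exact mul_le_of_le_one_left (by linarith) h2.le
              linarith
          rw [hdb]; linarith
        · have : (e0 - y0) * n0 + (e1 - y1) * n1 = fb := by rw [hfb, hfa]; ring
          rw [this]; exact hB
      · refine ⟨f0, f1, Or.inr (Or.inr ⟨rfl, rfl⟩), ?_, ?_⟩
        · have key : 3 * (α ^ 2 + β ^ 2 + α * β) ≤ 2 * β + α := by
            have hid : (2 * β + α) ^ 2 - 3 * (α ^ 2 + β ^ 2 + α * β) = (β - α) * (β + 2 * α) := by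
              ring
            have h1 : 3 * (α ^ 2 + β ^ 2 + α * β) ≤ (2 * β + α) ^ 2 := by
              linarith [hid, mul_nonneg (sub_nonneg.2 hαβ) (by linarith : 0 ≤ β + 2 * α)]
            by_cases h2 : 1 ≤ 2 * β + α
            · linarith
            · push Not at h2
              have h3 : (2 * β + α) ^ 2 ≤ 2 * β + α := by
                rw [sq]; exact mul_le_of_le_one_left (by linarith) h2.le
              linarith
          rw [hdc]; linarith
        · have : (f0 - y0) * n0 + (f1 - y1) * n1 = fc := by rw [hfc, hfa]; ring
          rw [this]; exact hC
    · -- `a` and `c` uphill: `b` is downhill (hB) and close (Core 1)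
      push Not at hC
      refine ⟨e0, e1, Or.inr (Or.inl ⟨rfl, rfl⟩), ?_, ?_⟩
      · -- foot of the perpendicular on `[a, c]`: `μ' = β + α/2`
        have hμ1 : 0 < 1 - (β + α / 2) := by linarith
        have hid : (1 - (β + α / 2)) * fa + (β + α / 2) * fc =
            α * ((f0 / 2 - e0) * n0 + (f1 / 2 - e1) * n1) := by
          rw [hfc, hfa, hy0, hy1]; ring
        set s := (f0 / 2 - e0) * n0 + (f1 / 2 - e1) * n1 with hs
        have hcomb : t < α * s := by
          rw [← hid]
          linarith [mul_pos hμ1 (sub_pos.2 hA), mul_nonneg (by linarith : 0 ≤ β + α / 2) (sub_pos.2 hC).le]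
        have hs2 : s ^ 2 ≤ 3 / 4 * (1 - n3 ^ 2) := by
          have hlen : (f0 / 2 - e0) ^ 2 + (f1 / 2 - e1) ^ 2 = 3 / 4 := by
            linear_combination (1 / 4) * hf - hef + he
          have hid2 : s ^ 2 + ((f0 / 2 - e0) * n1 - (f1 / 2 - e1) * n0) ^ 2 =
              ((f0 / 2 - e0) ^ 2 + (f1 / 2 - e1) ^ 2) * (n0 ^ 2 + n1 ^ 2) := by rw [hs]; ring
          rw [hlen, hn01] at hid2
          linarith [hid2, sq_nonneg ((f0 / 2 - e0) * n1 - (f1 / 2 - e1) * n0)]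
        have hαs : 0 < α * s := lt_of_le_of_lt ht0 hcomb
        have hα0 : 0 < α := by
          rcases lt_or_eq_of_le hα with h | h
          · exact h
          · rw [← h, zero_mul] at hαs; exact absurd hαs (lt_irrefl 0)
        have ht2' : t ^ 2 < (α * s) ^ 2 := by
          rw [pow_two, pow_two]; exact mul_self_lt_mul_self ht0 hcomb
        have hΔα : Δ ^ 2 < 3 / 2 * α ^ 2 := by
          have h1 : Δ ^ 2 * n3 ^ 2 < α ^ 2 * (3 / 4 * (1 - n3 ^ 2)) := by
            rw [← htΔ]
            calc t ^ 2 < (α * s) ^ 2 := ht2'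
              _ = α ^ 2 * s ^ 2 := by ring
              _ ≤ α ^ 2 * (3 / 4 * (1 - n3 ^ 2)) := mul_le_mul_of_nonneg_left hs2 (sq_nonneg α)
          have h2 : α ^ 2 * (3 / 4 * (1 - n3 ^ 2)) ≤ α ^ 2 * (3 / 2 * n3 ^ 2) :=
            mul_le_mul_of_nonneg_left (by linarith) (sq_nonneg α)
          have h3 : 0 < (3 / 2 * α ^ 2 - Δ ^ 2) * n3 ^ 2 := by linarith [h1, h2]
          have h4 : 0 < 3 / 2 * α ^ 2 - Δ ^ 2 := (mul_pos_iff_of_pos_right hn3pos).1 h3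
          linarith
        rw [hdb]
        linarith [hΔα, mul_pos hα0 (show 0 < 2 - 5 / 2 * α by linarith),
          mul_nonneg hβ (show 0 ≤ 1 - α - β by linarith)]
      · have : (e0 - y0) * n0 + (e1 - y1) * n1 = fb := by rw [hfb, hfa]; ring
        rw [this]; exact hB
  · push Not at hB
    by_cases hC : fc ≤ t
    · -- `a` and `b` uphill: `c` is downhill (hC) and close (Core 1, mirrored)
      refine ⟨f0, f1, Or.inr (Or.inr ⟨rfl, rfl⟩), ?_, ?_⟩
      · have hμ1 : 0 < 1 - (α + β / 2) := by linarith
        have hid : (1 - (α + β / 2)) * fa + (α + β / 2) * fb =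
            β * ((e0 / 2 - f0) * n0 + (e1 / 2 - f1) * n1) := by
          rw [hfb, hfa, hy0, hy1]; ring
        set s := (e0 / 2 - f0) * n0 + (e1 / 2 - f1) * n1 with hs
        have hcomb : t < β * s := by
          rw [← hid]
          linarith [mul_pos hμ1 (sub_pos.2 hA), mul_nonneg (by linarith : 0 ≤ α + β / 2) (sub_pos.2 hB).le]
        have hs2 : s ^ 2 ≤ 3 / 4 * (1 - n3 ^ 2) := by
          have hlen : (e0 / 2 - f0) ^ 2 + (e1 / 2 - f1) ^ 2 = 3 / 4 := by
            linear_combination (1 / 4) * he - hef + hf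
          have hid2 : s ^ 2 + ((e0 / 2 - f0) * n1 - (e1 / 2 - f1) * n0) ^ 2 =
              ((e0 / 2 - f0) ^ 2 + (e1 / 2 - f1) ^ 2) * (n0 ^ 2 + n1 ^ 2) := by rw [hs]; ring
          rw [hlen, hn01] at hid2
          linarith [hid2, sq_nonneg ((e0 / 2 - f0) * n1 - (e1 / 2 - f1) * n0)]
        have hβs : 0 < β * s := lt_of_le_of_lt ht0 hcomb
        have hβ0 : 0 < β := by
          rcases lt_or_eq_of_le hβ with h | h
          · exact h
          · rw [← h, zero_mul] at hβs; exact absurd hβs (lt_irrefl 0)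
        have ht2' : t ^ 2 < (β * s) ^ 2 := by
          rw [pow_two, pow_two]; exact mul_self_lt_mul_self ht0 hcomb
        have hΔβ : Δ ^ 2 < 3 / 2 * β ^ 2 := by
          have h1 : Δ ^ 2 * n3 ^ 2 < β ^ 2 * (3 / 4 * (1 - n3 ^ 2)) := by
            rw [← htΔ]
            calc t ^ 2 < (β * s) ^ 2 := ht2'
              _ = β ^ 2 * s ^ 2 := by ring
              _ ≤ β ^ 2 * (3 / 4 * (1 - n3 ^ 2)) := mul_le_mul_of_nonneg_left hs2 (sq_nonneg β)
          have h2 : β ^ 2 * (3 / 4 * (1 - n3 ^ 2)) ≤ β ^ 2 * (3 / 2 * n3 ^ 2) :=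
            mul_le_mul_of_nonneg_left (by linarith) (sq_nonneg β)
          have h3 : 0 < (3 / 2 * β ^ 2 - Δ ^ 2) * n3 ^ 2 := by linarith [h1, h2]
          have h4 : 0 < 3 / 2 * β ^ 2 - Δ ^ 2 := (mul_pos_iff_of_pos_right hn3pos).1 h3
          linarith
        rw [hdc]
        linarith [hΔβ, mul_pos hβ0 (show 0 < 2 - 5 / 2 * β by linarith),
          mul_nonneg hα (show 0 ≤ 1 - α - β by linarith)]
      · have : (f0 - y0) * n0 + (f1 - y1) * n1 = fc := by rw [hfc, hfa]; ring
        rw [this]; exact hC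
    · -- all three uphill contradicts the barycentric identity
      push Not at hC
      exfalso
      have h1 : 0 < 1 - α - β := by linarith
      linarith [mul_pos h1 (sub_pos.2 hA), mul_nonneg hα (sub_pos.2 hB).le,
        mul_nonneg hβ (sub_pos.2 hC).le, hrel, ht0]


end Summit.Ventures.Crystal3D.Theorems

end
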